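import Summits.QuantumFields.YangMills.Theorems.BalabanUVNodesN06Row17LocalClauseAtFlat
import Literature.MathematicalPhysics.QuantumFieldTheory.Balaban1983to89.B9WalkLettersCoordsS

/-!
# BalabanUVNodes ∕ N06 ([B9], `Dag.B9_main`) — «G_□(1) is positive» AT THE WALK-LETTER CUBE DATA: the flat positivity of the padded local bond operator
# `Δ_{a,□}(1)` over the enlarged-cube site set `□̃ = cubeDomY x c` of W-a (`B9WalkLettersCoordsS`), for any bond cut-off living on □̃'s blocks

Track A of `YM-PLAN.md` (cell `pub-ymgap`, HUMAN RULING D-0062), node **N06** = [Balaban1985BackgroundPropagators] Thms 3.1–3.15; seat `pub-ymgap-dag-n06-j`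
(bundle F5, rows 15–17), g22, FILE 3.  A HELPER (count-neutral, `--supports` only).

WHAT.  `…N06Row17LocalClauseAtFlat.posDefTr_padDeltaALocY_one` (this seat, FILE 2) proves [4]'s «G_□(1) is positive» ([B9] p. 416) for print's local bond
operator at node00-def-Y's FILE 40 letters over ANY cube site set `D`, under the geometric hypothesis «every block of 𝔅 containing a bond of the cut-off `χ`
lies in `D`».  At W-a's cube data the site set of the local inverses is `cubeDomY x c = {z : blkOf z ∈ cubeBlksY x c}` — a UNION OF BLOCKS of 𝔅 (the blocks
`QbigT` of the enlarged cube □̃) — so the hypothesis reduces to «every `χ`-bond starts in □̃» (`hχ□`), which any cut-off to the bonds of `□ ⊂ □̃` satisfies: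
* `blocks_of_cut_sub_cubeDomY` — the reduction;
* ★★★ `posDefTr_padDeltaALocY_one_cubeDomY` — `PosDefTr 1 (padDeltaALocY x.toKIdx (parSymY) (parBY) (cubeDomY x c) (cutMulY χP) (cutMulY χ) 1)` for 0∕1-valued
  `χP`, `χ` with `χ b ≠ 0 → b₋ ∈ cubeDomY x c`; `isUnit_padDeltaALocY_one_cubeDomY`; ★ `localClause_GAsqY_one_cubeDomY` (row 17's local clause — both
  conjuncts of `hGsqA` — INHABITED at `U = 1` at the cube data of record, any scale `c′ ≥ 0`: the A6 reading for the A-side walk-letter instance).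
HONEST FRAMING.  Bookkeeping over FILE 2 (finite-dimensional linear algebra + [4] Sect. A at `U = 1`); Cor. 3.6 at `U ≠ 1` NOT proved; nothing of [B9]'s estimates;
COUNT-NEUTRAL; N06 NOT discharged; nothing continuum ∕ OS ∕ mass gap ∕ Clay.  0 `def`, 0 `sorry`.
-/

noncomputable section

namespace Summit.QuantumFields.YangMills.BalabanUVNodes.N06Row17LocalClauseAtFlatCubeDom

open Literature.MathematicalPhysics.QuantumFieldTheory.Balaban1983to89
open Literature.MathematicalPhysics.QuantumFieldTheory.Balaban1983to89.Node00
open Literature.MathematicalPhysics.QuantumFieldTheory.Balaban1983to89.Node00.OpsYDeltaALocal (padDeltaALocY GAsqY)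
open Literature.MathematicalPhysics.QuantumFieldTheory.Balaban1983to89.B9Thm311ReadingCoords (PosDefTr)
open Literature.MathematicalPhysics.QuantumFieldTheory.Balaban1983to89.B9Thm37CubeCoverCommutators (cutMulY)
open Literature.MathematicalPhysics.QuantumFieldTheory.Balaban1983to89.B9CoReadingCoords (coordOpK)
open Literature.MathematicalPhysics.QuantumFieldTheory.Balaban1983to89.B9CoReadingCoordsTranspose (TrIdx trBasis)
open Literature.MathematicalPhysics.QuantumFieldTheory.Balaban1983to89.B9Thm37Glue (IsTransposePair)
open Literature.MathematicalPhysics.QuantumFieldTheory.Balaban1983to89.B6Geom246MultiLevelBox (blkOf)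
open Literature.MathematicalPhysics.QuantumFieldTheory.Balaban1983to89.B6Cover236MultiLevelBlocks (cubes)
open Literature.MathematicalPhysics.QuantumFieldTheory.Balaban1983to89.B9PinMembersKLevelV1 (MemberY)
open Literature.MathematicalPhysics.QuantumFieldTheory.Balaban1983to89.B9WalkLettersCoordsS (cubeBlksY cubeDomY)
open OpsYNablaBridge (chartY)
open Summit.QuantumFields.YangMills.BalabanUVNodes.N06Row17LocalClauseAtFlat (posDefTr_padDeltaALocY_one isUnit_padDeltaALocY_one localClause_GAsqY_one)
open scoped Matrix
open scoped Matrix.Norms.L2Operator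

variable {N : ℕ} {d ℓ : ℕ} {hd : 1 ≤ d + 1} {hL : Odd (ℓ + 1) ∧ 1 < ℓ + 1} {b₀ b₁ : ℝ} {Mstar : ℕ} (x : MemberY d ℓ hd hL b₀ b₁ Mstar)

/-- **THE GEOMETRIC HYPOTHESIS AT `□̃`**: since `cubeDomY x c` is the union of the blocks `cubeBlksY x c`, a bond cut-off all of whose bonds START in □̃ vanishes on
every bond lying inside a block not contained in □̃ — the hypothesis `hD` of FILE 2 at `D := cubeDomY x c`.
[cite: Balaban1985BackgroundPropagators, p.408 («□ ⊂ □̃»), (3.87) p.409; Balaban1984PropagatorsII, (2.36) p.229] -/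
theorem blocks_of_cut_sub_cubeDomY (c : ↥(cubes x.toKIdx.D.toDomains)) {χ : FBondY x.toKIdx → ℝ}
    (hχD : ∀ b : FBondY x.toKIdx, χ b ≠ 0 → chartY x.toKIdx b.src ∈ cubeDomY x c) :
    ∀ z : SiteY x.toKIdx, z ∉ cubeDomY x c → ∀ b : FBondY x.toKIdx,
      blkOf x.toKIdx.D.toDomains (chartY x.toKIdx b.src) = blkOf x.toKIdx.D.toDomains z →
        blkOf x.toKIdx.D.toDomains (chartY x.toKIdx b.tgt) = blkOf x.toKIdx.D.toDomains z → χ b = 0 := by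
  intro z hz b hs _
  by_contra hb
  have h := hχD b hb
  simp only [cubeDomY, Finset.mem_filter, Finset.mem_univ, true_and] at h hz
  exact hz (hs ▸ h)

/-- ★★★ **«G_□(1) IS POSITIVE» AT THE CUBE DATA OF RECORD**: for every member `x`, every cube `c` of its cover, every 0∕1-valued block cut-off `χP` and every
0∕1-valued bond cut-off `χ` whose bonds start in `□̃ = cubeDomY x c`, the padded compression of print's local bond operator `Δ_{a,□}(1)` (def-Y FILE 40, site
set `cubeDomY x c`) is positive definite for the trace pairing. [cite: Balaban1985BackgroundPropagators, Thm 3.11 proof p.416 («In [4] we have proved that the operator G_□(1) is positive»), Cor. 3.5 p.407, pp.408–409] -/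
theorem posDefTr_padDeltaALocY_one_cubeDomY (c : ↥(cubes x.toKIdx.D.toDomains)) {χP : BlkY x.toKIdx → ℝ} (hχP : ∀ y, χP y = 0 ∨ χP y = 1)
    {χ : FBondY x.toKIdx → ℝ} (hχ : ∀ b, χ b = 0 ∨ χ b = 1) (hχD : ∀ b : FBondY x.toKIdx, χ b ≠ 0 → chartY x.toKIdx b.src ∈ cubeDomY x c) :
    PosDefTr (fun _ => (1 : ℝ))
      (padDeltaALocY x.toKIdx (parSymY x.toKIdx) (parBY x.toKIdx) (cubeDomY x c) (cutMulY χP) (cutMulY χ)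
        (fun _ _ => 1 : CfgY (Matrix (Fin N) (Fin N) ℂ) x.toKIdx)) :=
  posDefTr_padDeltaALocY_one x.toKIdx (cubeDomY x c) hχP hχ (blocks_of_cut_sub_cubeDomY x c hχD)

/-- hence the padded `Δ_{a,□}(1)` over □̃ is a unit (`G_□(1) = GAsqY … 1` is its genuine inverse on the cut-off's bonds).
[cite: Balaban1985BackgroundPropagators, pp.408–409 (G_□), Cor. 3.5 p.407] -/
theorem isUnit_padDeltaALocY_one_cubeDomY (c : ↥(cubes x.toKIdx.D.toDomains)) {χP : BlkY x.toKIdx → ℝ} (hχP : ∀ y, χP y = 0 ∨ χP y = 1)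
    {χ : FBondY x.toKIdx → ℝ} (hχ : ∀ b, χ b = 0 ∨ χ b = 1) (hχD : ∀ b : FBondY x.toKIdx, χ b ≠ 0 → chartY x.toKIdx b.src ∈ cubeDomY x c) :
    IsUnit (padDeltaALocY x.toKIdx (parSymY x.toKIdx) (parBY x.toKIdx) (cubeDomY x c) (cutMulY χP) (cutMulY χ)
      (fun _ _ => 1 : CfgY (Matrix (Fin N) (Fin N) ℂ) x.toKIdx)) :=
  isUnit_padDeltaALocY_one x.toKIdx (cubeDomY x c) hχP hχ (blocks_of_cut_sub_cubeDomY x c hχD)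

/-- ★ **ROW 17's LOCAL CLAUSE INHABITED AT `U = 1` AT THE CUBE DATA OF RECORD** (A6): both conjuncts of `hGsqA` — self-transpose and positive
semi-definite — for the scaled coordinate model of def-Y's `G_□(1) = GAsqY … (cubeDomY x c) (cutMulY χP) (cutMulY χ) 1`, any direction index type, any `c′ ≥ 0`.
[cite: Balaban1985BackgroundPropagators, Thm 3.11 p.416 («positivity of the operators G_□»), Cor. 3.5 p.407; Balaban1984PropagatorsII, p.228] -/
theorem localClause_GAsqY_one_cubeDomY {Dd : Type} [Fintype Dd] (c : ↥(cubes x.toKIdx.D.toDomains)) {χP : BlkY x.toKIdx → ℝ}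
    (hχP : ∀ y, χP y = 0 ∨ χP y = 1) {χ : FBondY x.toKIdx → ℝ} (hχ : ∀ b, χ b = 0 ∨ χ b = 1)
    (hχD : ∀ b : FBondY x.toKIdx, χ b ≠ 0 → chartY x.toKIdx b.src ∈ cubeDomY x c) {c' : ℝ} (hc' : 0 ≤ c') :
    IsTransposePair
        (c' • coordOpK (trBasis N) (fun _ : Dd =>
          (GAsqY x.toKIdx (parSymY x.toKIdx) (parBY x.toKIdx) (cubeDomY x c) (cutMulY χP) (cutMulY χ)
            (fun _ _ => 1 : CfgY (Matrix (Fin N) (Fin N) ℂ) x.toKIdx)).restrictScalars ℝ))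
        (c' • coordOpK (trBasis N) (fun _ : Dd =>
          (GAsqY x.toKIdx (parSymY x.toKIdx) (parBY x.toKIdx) (cubeDomY x c) (cutMulY χP) (cutMulY χ)
            (fun _ _ => 1 : CfgY (Matrix (Fin N) (Fin N) ℂ) x.toKIdx)).restrictScalars ℝ)) ∧
      ∀ v : FBondY x.toKIdx × Dd × TrIdx N × TrIdx N → ℝ,
        0 ≤ v ⬝ᵥ (c' • coordOpK (trBasis N) (fun _ : Dd =>
          (GAsqY x.toKIdx (parSymY x.toKIdx) (parBY x.toKIdx) (cubeDomY x c) (cutMulY χP) (cutMulY χ)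
            (fun _ _ => 1 : CfgY (Matrix (Fin N) (Fin N) ℂ) x.toKIdx)).restrictScalars ℝ)) v :=
  localClause_GAsqY_one x.toKIdx (cubeDomY x c) hχP hχ (blocks_of_cut_sub_cubeDomY x c hχD) hc'

end Summit.QuantumFields.YangMills.BalabanUVNodes.N06Row17LocalClauseAtFlatCubeDom

end
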